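import Literature.NumberTheory.LFunctions.LogIntegral
import HarnessLib

/-!
# Discharges of `Literature.NumberTheory.LFunctions.strictMonoOn_logIntegral` and
# `Literature.NumberTheory.LFunctions.strictMonoOn_offsetLogIntegral`: `li` and `Li` are strictly increasing on `(1, ∞)`

D-0014 keeps `Literature/` sorry-free by stating cited results as named facts `def X : Prop`.
This sibling file of `Literature.NumberTheory.LFunctions.LogIntegral` (it imports only that
module) proves the named fact `Literature.NumberTheory.LFunctions.strictMonoOn_logIntegral` —
`StrictMonoOn logIntegral (Ioi 1)` — as `theorem strictMonoOn_logIntegral_holds`; users holding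
`(h : strictMonoOn_logIntegral)` are fed `strictMonoOn_logIntegral_holds`.

`Literature.NumberTheory.LFunctions.logIntegral` is *defined* by Ramanujan's (Nielsen's) series
`li x = γ + log (log x) + Σ_{n ≥ 1} (log x)^n / (n · n!)`, i.e. Abramowitz–Stegun 5.1.10
(`Ei x = γ + ln x + Σ_{n ≥ 1} xⁿ / (n · n!)`, `x > 0`) at `log x`, using 5.1.3
(`li x = ∫₀ˣ dt / ln t = Ei (ln x)`, `x > 1`). Strict monotonicity on `(1, ∞)` — in the source,
the positivity of the integrand `1 / ln t` of 5.1.3 on `(1, ∞)` — is read off the series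
without derivatives: for `1 < x < y` one has `0 < log x < log y`, hence
`log (log x) < log (log y)`; each term `(log x)^(n+1) / ((n+1) · (n+1)!)` is nondecreasing in
`x` on `[1, ∞)` (`logIntegralSeriesTerm_mono`); and the series is (absolutely) summable for
every real `x` by comparison with the tail `Σ |log x|^(n+1) / (n+1)!` of the exponential series
(Mathlib `Real.summable_pow_div_factorial`), so the termwise inequality passes to the sums
(`Summable.tsum_le_tsum`). Cross-checked against Oldham–Myland–Spanier, *An Atlas of
Functions*, 2nd ed.: 25:13:2 and 37:0:2 `li(x) = Ei(ln x)`, 37:6:6 with 37:6:1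
`Ei(x) = ln |x| + γ + Σ_{j ≥ 1} x^j / (j · j!)`, and §37:2 ("All three functions [Ei, Ein, li]
increase without limit as x → ∞").

A second section discharges the companion fact
`Literature.NumberTheory.LFunctions.strictMonoOn_offsetLogIntegral` — `StrictMonoOn offsetLogIntegral (Ioi 1)` for the
offset logarithmic integral `Li x = ∫₂ˣ dt / log t` (an honest interval integral) — as
`theorem strictMonoOn_offsetLogIntegral_holds`. Here no series is involved: for `1 < x < y`,
additivity of the interval integral gives `Li y − Li x = ∫ₓʸ dt / log t`
(`intervalIntegral.integral_interval_sub_left`; the integrand `(log t)⁻¹` is continuous on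
`(1, ∞) ⊇ [[2, x]], [[2, y]], [[x, y]]`, hence interval integrable there), and this integral
is positive because `1 / log t > 0` on `(x, y) ⊆ (1, ∞)`
(`intervalIntegral.intervalIntegral_pos_of_pos_on`). This is exactly the positivity of the
integrand of Abramowitz–Stegun 5.1.3 (`li x = ∫₀ˣ dt / ln t`, `x > 1`) restricted to `t ≥ 2`.
On the locator carried by the fact's docstring ("Schoenfeld 1976, §1"): Schoenfeld's paper
continues the section numbering of Rosser–Schoenfeld 1975 and consists of §§6–9 (p. 337:
"We use the references and continue the paragraph numbering of the original paper by Rosser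
and Schoenfeld [11]"); it uses `li` in Corollary 1, (6.18)–(6.19), p. 339
(`|π(x) − li(x)| < √x log x / (8π)` for `x ≥ 2657` under RH) and in the proof on p. 340, and
does not itself state the (elementary) monotonicity, which is why the discharge below is
tagged with the Abramowitz–Stegun locator.

## References

* M. Abramowitz, I. A. Stegun (eds.), *Handbook of Mathematical Functions with Formulas, Graphs,
  and Mathematical Tables*, NBS Applied Mathematics Series 55, 1964, §5.1, formulas 5.1.3 and
  5.1.10. [cite: AbramowitzStegun1964]
* K. B. Oldham, J. Myland, J. Spanier, *An Atlas of Functions*, 2nd ed., Springer 2009, §25:13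
  (25:13:2), ch. 37 (37:0:2, §37:2, 37:6:1, 37:6:6). [cite: OldhamMylandSpanier2009]
* L. Schoenfeld, *Sharper bounds for the Chebyshev functions θ(x) and ψ(x). II*, Math. Comp. 30
  (1976), no. 134, 337–360, doi:10.1090/S0025-5718-1976-0457374-X; Corollary 1, (6.18)–(6.19),
  p. 339. [cite: Schoenfeld1976]
-/

noncomputable section

open Real Set
open scoped Nat

namespace Literature.NumberTheory.LFunctions

section StrictMonoOnLogIntegral

/-- The terms of Ramanujan's series for `li` are nondecreasing in `x` on `[1, ∞)`: each is a
positive multiple of `(log x)^(n+1)`, and `0 ≤ log x ≤ log y` for `1 ≤ x ≤ y`. [folklore] -/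
theorem logIntegralSeriesTerm_mono {x y : ℝ} (hx : 1 ≤ x) (hxy : x ≤ y) (n : ℕ) :
    logIntegralSeriesTerm x n ≤ logIntegralSeriesTerm y n := by
  have hx0 : 0 < x := lt_of_lt_of_le one_pos hx
  have hlog : Real.log x ≤ Real.log y := Real.log_le_log hx0 hxy
  have hlog0 : 0 ≤ Real.log x := Real.log_nonneg hx
  unfold logIntegralSeriesTerm
  exact div_le_div_of_nonneg_right (pow_le_pow_left₀ hlog0 hlog (n + 1)) (by positivity)

/-- **Discharge of `strictMonoOn_logIntegral`**: `li` is strictly increasing on `(1, ∞)`.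
Abramowitz–Stegun 5.1.3 gives `li x = ∫₀ˣ dt / ln t = Ei (ln x)` for `x > 1`, with integrand
`1 / ln t > 0` on `(1, ∞)`; for the series 5.1.10 (at `log x`) by which `Literature.NumberTheory.LFunctions.logIntegral` is
defined the claim is read off directly: `log ∘ log` is strictly increasing on `(1, ∞)`, the
series is termwise nondecreasing in `x` (`logIntegralSeriesTerm_mono`) and summable for every
real `x` (its general term is bounded in absolute value by `|log x|^(n+1) / (n+1)!`, a tail of
the exponential series). [cite: AbramowitzStegun1964, 5.1.3 with 5.1.10] -/
theorem strictMonoOn_logIntegral_holds : strictMonoOn_logIntegral := by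
  -- summability of Ramanujan's series for every real argument (comparison with `exp |log x|`)
  have hsummable : ∀ x : ℝ, Summable (logIntegralSeriesTerm x) := by
    intro x
    have h : Summable fun n : ℕ => |Real.log x| ^ (n + 1) / ((n + 1)! : ℝ) :=
      (summable_nat_add_iff 1).mpr (Real.summable_pow_div_factorial |Real.log x|)
    refine Summable.of_norm_bounded h fun n => ?_
    have hfac : (0 : ℝ) < ((n + 1)! : ℝ) := by positivity
    have hn : (1 : ℝ) ≤ (n + 1 : ℝ) := by
      have : (0 : ℝ) ≤ (n : ℝ) := n.cast_nonneg
      linarith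
    rw [logIntegralSeriesTerm, Real.norm_eq_abs, abs_div, abs_pow,
      abs_of_pos (mul_pos (lt_of_lt_of_le one_pos hn) hfac)]
    exact div_le_div_of_nonneg_left (by positivity) hfac (le_mul_of_one_le_left hfac.le hn)
  intro x hx y _ hxy
  rw [Set.mem_Ioi] at hx
  have hx0 : 0 < x := lt_trans one_pos hx
  have hlog : Real.log x < Real.log y := Real.log_lt_log hx0 hxy
  have hloglog : Real.log (Real.log x) < Real.log (Real.log y) :=
    Real.log_lt_log (Real.log_pos hx) hlog
  have hsum : ∑' n, logIntegralSeriesTerm x n ≤ ∑' n, logIntegralSeriesTerm y n :=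
    Summable.tsum_le_tsum (logIntegralSeriesTerm_mono hx.le hxy.le) (hsummable x) (hsummable y)
  unfold logIntegral
  linarith

end StrictMonoOnLogIntegral

section StrictMonoOnOffsetLogIntegral

open _root_.MeasureTheory

/-- Points of `[[a, b]]` exceed `1` when `a, b > 1`. [folklore] -/
private theorem one_lt_of_mem_uIcc' {a b t : ℝ} (ha : 1 < a) (hb : 1 < b)
    (ht : t ∈ uIcc a b) : 1 < t := by
  rcases Set.mem_uIcc.1 ht with h | h <;> linarith [h.1]

/-- The integrand `(log t)⁻¹` of `Li` is interval integrable between any two points of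
`(1, ∞)`: `log` is continuous and nonvanishing on `[[a, b]] ⊆ (1, ∞)`. [folklore] -/
private theorem intervalIntegrable_inv_log {a b : ℝ} (ha : 1 < a) (hb : 1 < b) :
    IntervalIntegrable (fun t : ℝ => (Real.log t)⁻¹) volume a b := by
  refine ContinuousOn.intervalIntegrable ((Real.continuousOn_log.mono ?_).inv₀ ?_)
  · intro t ht
    simp only [mem_compl_iff, mem_singleton_iff]
    exact (zero_lt_one.trans (one_lt_of_mem_uIcc' ha hb ht)).ne'
  · intro t ht
    exact (Real.log_pos (one_lt_of_mem_uIcc' ha hb ht)).ne'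

/-- For `1 < x` and `1 < y`: `Li y − Li x = ∫ₓʸ dt / log t` (additivity of the interval
integral `Li = ∫₂`; both `[[2, x]]` and `[[2, y]]` lie in `(1, ∞)`, where `(log t)⁻¹` is
continuous). [folklore] -/
theorem offsetLogIntegral_sub_offsetLogIntegral {x y : ℝ} (hx : 1 < x) (hy : 1 < y) :
    offsetLogIntegral y - offsetLogIntegral x = ∫ t in x..y, (Real.log t)⁻¹ :=
  intervalIntegral.integral_interval_sub_left (intervalIntegrable_inv_log one_lt_two hy)
    (intervalIntegrable_inv_log one_lt_two hx)

/-- **Discharge of `strictMonoOn_offsetLogIntegral`**: `Li x = ∫₂ˣ dt / log t` is strictly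
increasing on `(1, ∞)`. For `1 < x < y`, `Li y − Li x = ∫ₓʸ dt / log t`
(`offsetLogIntegral_sub_offsetLogIntegral`) and the integrand `1 / log t` is positive on
`(x, y) ⊆ (1, ∞)` — the positivity of the integrand of Abramowitz–Stegun 5.1.3
(`li x = ∫₀ˣ dt / ln t`, `x > 1`); Schoenfeld 1976 (whose §§ are numbered 6–9) uses `li` in
Corollary 1, (6.18)–(6.19), p. 339, without restating this elementary property.
[cite: AbramowitzStegun1964, 5.1.3] -/
theorem strictMonoOn_offsetLogIntegral_holds : strictMonoOn_offsetLogIntegral := by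
  intro x hx y hy hxy
  rw [Set.mem_Ioi] at hx hy
  have hpos : 0 < ∫ t in x..y, (Real.log t)⁻¹ :=
    intervalIntegral.intervalIntegral_pos_of_pos_on (intervalIntegrable_inv_log hx hy)
      (fun t ht => inv_pos.mpr (Real.log_pos (hx.trans ht.1))) hxy
  linarith [offsetLogIntegral_sub_offsetLogIntegral hx hy]

end StrictMonoOnOffsetLogIntegral

end Literature.NumberTheory.LFunctions
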